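import Summits.ABC.StewartYu.PadicG3OfData
import HarnessLib

/-!
# Cell abc-stewartyu, crux `Y07Odd` (stmt-ABC-19658), line `gen3-slab-odd`: the exponent class of the half-step on TWO SIGN CLASSES
# (`cls(vᵢ) = sgnᵢ ∈ {±1}`, levels `s ≥ 1`)

`Summits/ABC/StewartYu/PadicG3ExpClassPM.lean` — sequel to `PadicG3OfData` (cell `abc-stewartyu`, design HOME/p2/HALFSTEP-ODD.md §LEVEL INVARIANT;
seat p2-g4, F-odd lead).  Theorems on `G3Setup`; no named fact.  From level `1` on the exponent family lies in the two classes `cls(vᵢ) = ±1`;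
with `η_j = ζ^{r_j}` (`ζ` primitive of order `p − 1 = 2M`, `ζ^M = −1`):

* `sum_mul_mod_of_cls_eq_sign` — `cls v = sgn ∈ {±1}` ⇒ `Σ_j r_j v_j = (p−1)·q + M·δ` with `δ = 0` (`sgn = 1`) or `δ = 1` (`sgn = −1`);
* **`exists_expClass_pm`** — the natural root exponents `eᵢ = rootExp L vᵢ s` lie in one exponent class `Σ_j r_j eᵢⱼ = c₀ + kᵢ·M` with
  `kᵢ = 2qᵢ s + δᵢ s + a` (`a, c₀` independent of `i`): the PARITY of `kᵢ` is the sign class of `i` up to the global parity of `a + s`-terms,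
  so the two vectors `C₀, C₁` of `PadicG3HalfSeparation` are the two sign classes.

WHAT THIS IS NOT: no levels; no crux moves.

References: K. Yu, Compositio 74 (1990) (2.101)–(2.106); cell memo HOME/p3/memo-05 §3 (the ± classes).
-/

noncomputable section

open NormedSpace Finset
open Literature.NumberTheory.Transcendental

namespace Summit.ABC.StewartYu

namespace G3Setup

variable {p : ℕ} [Fact p.Prime] (S : G3Setup p)

/-- **`cls v = ±1 ⇒ Σ_j r_j v_j = (p−1)·q + M·δ`**, `δ ∈ {0, 1}` the sign class (`M = (p−1)/2`, `ζ^M = −1`). [folklore] -/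
theorem sum_mul_mod_of_cls_eq_sign {ζ : ℚ_[p]} (hζ : IsPrimitiveRoot ζ (p - 1)) (hζM : ζ ^ ((p - 1) / 2) = -1)
    (r : Fin S.n → ℕ) (hη : ∀ j, S.η j = ζ ^ r j) (v : Fin S.n → ℤ) {sgn : ℤ} (hsgn : sgn = 1 ∨ sgn = -1)
    (hcls : S.cls v = (sgn : ℚ_[p])) :
    ∃ q : ℤ, ∑ j, (r j : ℤ) * v j = ((p - 1 : ℕ) : ℤ) * q + (((p - 1) / 2 : ℕ) : ℤ) * (if sgn = 1 then 0 else 1) := by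
  have hζ0 : ζ ≠ 0 := hζ.ne_zero (by have := S.hp3; omega)
  have hzs : ∀ (t : Finset (Fin S.n)), ζ ^ (∑ j ∈ t, (r j : ℤ) * v j) = ∏ j ∈ t, ζ ^ ((r j : ℤ) * v j) := by
    intro t
    induction t using Finset.induction_on with
    | empty => simp
    | insert j t hj ih => rw [sum_insert hj, prod_insert hj, zpow_add₀ hζ0, ih]
  have hprod : S.cls v = ζ ^ (∑ j, (r j : ℤ) * v j) := by
    unfold cls
    rw [hzs]
    refine prod_congr rfl fun j _ => ?_
    rw [hη j, ← zpow_natCast, ← zpow_mul]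
  set E : ℤ := ∑ j, (r j : ℤ) * v j with hE
  rcases hsgn with h1 | h1
  · -- `ζ^E = 1`
    rw [h1, if_pos rfl, mul_zero]
    rw [hprod, h1] at hcls
    push_cast at hcls
    obtain ⟨q, hq⟩ := (hζ.zpow_eq_one_iff_dvd _).mp hcls
    exact ⟨q, by rw [add_zero]; exact hq⟩
  · -- `ζ^E = −1 = ζ^M` ⇒ `ζ^{E − M} = 1`
    rw [h1, if_neg (by norm_num), mul_one]
    rw [hprod, h1] at hcls
    push_cast at hcls
    have hEM : ζ ^ (E - (((p - 1) / 2 : ℕ) : ℤ)) = 1 := by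
      rw [zpow_sub₀ hζ0, zpow_natCast, hζM, hcls]; norm_num
    obtain ⟨q, hq⟩ := (hζ.zpow_eq_one_iff_dvd _).mp hEM
    exact ⟨q, by linarith⟩

/-- **The exponent class on two sign classes.**  With `cls(vᵢ) = sgnᵢ ∈ {±1}` on `B` (box `|vᵢⱼ| ≤ L_j`), the root exponents
`eᵢ = rootExp L vᵢ s` satisfy `Σ_j r_j eᵢⱼ = c₀ + kᵢ·M` with `kᵢ = 2 qᵢ s + δᵢ s + a` where `(p−1) qᵢ + M δᵢ = Σ_j r_j vᵢⱼ`, `δᵢ ∈ {0,1}` the sign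
class of `i`, and `a, c₀` independent of `i`. [folklore] -/
theorem exists_expClass_pm {ζ : ℚ_[p]} (hζ : IsPrimitiveRoot ζ (p - 1)) (hζM : ζ ^ ((p - 1) / 2) = -1) (r : Fin S.n → ℕ)
    (hη : ∀ j, S.η j = ζ ^ r j) {ι : Type*} (v : ι → Fin S.n → ℤ) (B : Finset ι) (sgn : ι → ℤ)
    (hsgn : ∀ i, sgn i = 1 ∨ sgn i = -1) (hcls : ∀ i ∈ B, S.cls (v i) = (sgn i : ℚ_[p]))
    {L : Fin S.n → ℕ} (hL : ∀ i ∈ B, ∀ j, |v i j| ≤ (L j : ℤ)) (s : ℤ) :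
    ∃ (c₀ a : ℕ) (k : ι → ℕ) (q : ι → ℤ),
      (∀ i ∈ B, ∑ j, r j * S.rootExp L (v i) s j = c₀ + k i * ((p - 1) / 2)) ∧
      (∀ i ∈ B, ((p - 1 : ℕ) : ℤ) * q i + (((p - 1) / 2 : ℕ) : ℤ) * (if sgn i = 1 then 0 else 1) = ∑ j, (r j : ℤ) * v i j) ∧
      (∀ i ∈ B, (k i : ℤ) = 2 * (q i * s) + (if sgn i = 1 then 0 else 1) * s + a) := by
  classical
  have hev : Even (p - 1) := by
    have hp : p.Prime := Fact.out
    have hodd : Odd p := hp.odd_of_ne_two (by have := S.hp3; omega)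
    obtain ⟨m, hm⟩ := hodd
    exact ⟨m, by omega⟩
  have h2M : 2 * ((p - 1) / 2) = p - 1 := Nat.two_mul_div_two_of_even hev
  set M : ℕ := (p - 1) / 2 with hM
  have hM0 : 0 < (M : ℤ) := by have := S.hp3; exact_mod_cast (show 0 < (p - 1) / 2 by omega)
  set P : ℤ := ((p - 1 : ℕ) : ℤ) with hPdef
  have hPM : P = 2 * (M : ℤ) := by rw [hPdef, hM]; exact_mod_cast h2M.symm
  set A : ℤ := 2 * ∑ j, (r j : ℤ) * (L j * |s|) with hA
  have hA0 : 0 ≤ A := by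
    have : 0 ≤ ∑ j, (r j : ℤ) * (L j * |s|) := sum_nonneg fun j _ => by positivity
    rw [hA]; linarith
  set δ : ι → ℤ := fun i => if sgn i = 1 then 0 else 1 with hδ
  have hδ01 : ∀ i, δ i = 0 ∨ δ i = 1 := fun i => by by_cases h : sgn i = 1 <;> simp [hδ, h]
  -- `q i` and the exponent sums
  have hsum : ∀ i ∈ B, ∃ q : ℤ, P * q + (M : ℤ) * δ i = ∑ j, (r j : ℤ) * v i j ∧
      ((∑ j, r j * S.rootExp L (v i) s j : ℕ) : ℤ) = (P * q + (M : ℤ) * δ i) * s + A := by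
    intro i hi
    obtain ⟨q, hq⟩ := S.sum_mul_mod_of_cls_eq_sign hζ hζM r hη (v i) (hsgn i) (hcls i hi)
    refine ⟨q, by rw [hq], ?_⟩
    push_cast
    have he : ∀ j, ((S.rootExp L (v i) s j : ℕ) : ℤ) = v i j * s + 2 * (L j * |s|) := fun j => S.rootExp_cast (hL i hi) s j
    simp_rw [he]
    have : ∑ j, (r j : ℤ) * (v i j * s + 2 * (L j * |s|)) = (∑ j, (r j : ℤ) * v i j) * s + 2 * ∑ j, (r j : ℤ) * (L j * |s|) := by
      rw [sum_mul, mul_sum, ← sum_add_distrib]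
      exact sum_congr rfl fun j _ => by ring
    rw [this, hq, hA]
  choose! q hq he using hsum
  -- `a := A / M`, `c₀ := A % M`
  have hmod0 : 0 ≤ A % (M : ℤ) := Int.emod_nonneg _ hM0.ne'
  have hdiv0 : 0 ≤ A / (M : ℤ) := Int.ediv_nonneg hA0 hM0.le
  have hAP : A = (M : ℤ) * (A / (M : ℤ)) + A % (M : ℤ) := (Int.mul_ediv_add_emod A (M : ℤ)).symm
  have hk0 : ∀ i ∈ B, 0 ≤ 2 * (q i * s) + δ i * s + A / (M : ℤ) := by
    intro i hi
    have hnn : 0 ≤ (P * q i + (M : ℤ) * δ i) * s + A := by rw [← he i hi]; positivity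
    have hlt : A % (M : ℤ) < (M : ℤ) := Int.emod_lt_of_pos _ hM0
    have h1 : (M : ℤ) * (2 * (q i * s) + δ i * s + A / (M : ℤ)) + A % (M : ℤ) = (P * q i + (M : ℤ) * δ i) * s + A := by
      rw [hPM]; linarith [hAP]
    have h3 : -1 < 2 * (q i * s) + δ i * s + A / (M : ℤ) := by
      by_contra hc
      push Not at hc
      have : (M : ℤ) * (2 * (q i * s) + δ i * s + A / (M : ℤ)) ≤ (M : ℤ) * (-1) := mul_le_mul_of_nonneg_left hc hM0.le
      linarith
    linarith
  refine ⟨(A % (M : ℤ)).toNat, (A / (M : ℤ)).toNat, fun i => (2 * (q i * s) + δ i * s + A / (M : ℤ)).toNat, q, ?_,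
    fun i hi => hq i hi, ?_⟩
  · intro i hi
    zify
    rw [Int.toNat_of_nonneg hmod0, Int.toNat_of_nonneg (hk0 i hi)]
    have he' := he i hi
    push_cast at he'
    rw [he', hPM]
    linarith [hAP]
  · intro i hi
    rw [Int.toNat_of_nonneg (hk0 i hi), Int.toNat_of_nonneg hdiv0]

end G3Setup

end Summit.ABC.StewartYu

end
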